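import Summits.QuantumFields.YangMills.Theorems.LuscherReductionTwistedTraceScalingBODefectCoreNorm
import Summits.QuantumFields.YangMills.Theorems.LuscherReductionTwistedTraceScalingBOCapProfile
import Summits.QuantumFields.YangMills.Theorems.LuscherReductionTwistedTraceScalingBOCentralRatesTwo
import Summits.QuantumFields.YangMills.Theorems.LuscherReductionTwistedTraceScalingBOCentralWindow
import Summits.QuantumFields.YangMills.Theorems.LuscherReductionTwistedTraceScalingBOSupportGeometry
import Summits.QuantumFields.YangMills.Theorems.LuscherReductionTwistedTraceScalingBTFixedBeta
import HarnessLib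

/-!
# Input (2) of the (B-OD) currency: the (B-T) constant from below by the central quasimode — `(1 − β^{-1/5})·a₀·M₂^{γ,in} ≤ btC·K₁(1,1)`
# (lane A of S-BASE, crux `TwistedTraceScaling` stmt-QuantumFields-20203, C4-CORE, the (OD) pen; `pub/ym-fleet/ym-luscher-20007-p1/COARSE-DESIGN.md` §30.6 (c); `…BOCoreCurrency.core_currency`)

At ONE value of `β`, for the record profile `Ω_c β` and core weight `W_core = coreWeight β^{-1} (5β^{-1/2}btLog²β)`: IF the central quasimode floor
`|T₁(v') − c₁·M(v')| ≤ β^{-1/5}·c₁·M(v')` holds for all balanced capped `v'` with `|v'_{e,c}| ≤ T_β` and `‖v̂'‖ ≤ r_f/12` (`T₁(v') = fpFibreTransfer (oT 1 v') 1`,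
`M(v') = S·e^{−q(v̂')}/I₀` — this is the conjunct exported by `…BODefectCoreRecord.defect_core_record` / `…BOCentralQuasimodeRate.central_quasimode_rate`), THEN
★★ `btC_floor_of_quasimode` — `(1 − β^{-1/5})·(c₁·S/I₀)·M₂^{γ,in} ≤ btC L β (Ω_c β) β^{-1} (5β^{-1/2}btLog²β) · K₁^{(L³β)}(1,1)`,
`M₂^{γ,in} = ∫ 𝟙_{‖v̂‖≤r_f/12}(e^{−q(v̂)})²e^{−‖P_Γv̂‖²/β^{-2}} dπ` (`…BODefectCoreNorm.fpBOKernel_one_one_ge_of_quasimode`, the cap is a.e., `btC·K₁ = fpBOKernel(1,1)`).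
HONEST FRAMING: bookkeeping for a stub of a child of the CONDITIONAL route R2b1; (C5), the hOD assembly, (B-ST), C4-CORE OPEN; not a gap, not Clay.
-/

set_option autoImplicit false

noncomputable section

open MeasureTheory Filter Topology Real
open scoped BigOperators
open Literature.MathematicalPhysics.QuantumFieldTheory
open Literature.MathematicalPhysics.QuantumLattice

namespace Summit.QuantumFields.YangMills.Theorems.FemtoTransferGap.TwoLattice.ConstTube

open Summit.QuantumFields.YangMills.Theorems.FemtoTransferGap
open Summit.QuantumFields.YangMills.Theorems.FemtoTransferGap.TwoLattice
open Summit.QuantumFields.YangMills.Theorems.FemtoTransferGap.TwoLattice.Avg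
open Summit.QuantumFields.YangMills.Theorems.FemtoTransferGap.TwoLattice.Stiff
open Summit.QuantumFields.YangMills.Theorems.FemtoTransferGap.TwoLattice.GnChart

variable {L : ℕ} [NeZero L]

set_option maxHeartbeats 800000 in
-- the record profile / weight / window expressions are large; the instantiation of `fpBOKernel_one_one_ge_of_quasimode` exceeds the default budget.
/-- ★★ **THE (B-T) CONSTANT FROM BELOW BY THE CENTRAL QUASIMODE** (see the module docstring). [cite: Luscher1983, §3] -/
theorem btC_floor_of_quasimode {β : ℝ} (hβ : 0 < β) {c₁ : ℝ}
    (hfloor : ∀ v' : Edge 3 L → Fin 3 → ℝ, v' ∈ capBalancedSet L →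
      (∀ (e : Edge 3 L) (c : Fin 3), |v' e c| ≤ (9 * (L : ℝ) * (5 * (powScale (1 / 2) β * btLog β ^ 2)) + (powScale 1 β))) → ‖linkEmbed L v'‖ ≤ (min (1 / 40) (powScale (1 / 2) β * btLog β)) / 12 →
      |fpFibreTransfer L β (fun x : LinkSpace L => {x : LinkSpace L | linkCurry x ∈ capBalancedSet L}.indicator (fun _ => (1 : ℝ)) x *
            frozenProfile L (fun β' => stiffGaussExp L (β' / 2) β') (fun β' => min (1 / 40) (powScale (1 / 2) β' * btLog β')) β x)
          (coreWeight L (powScale 1 β) (5 * (powScale (1 / 2) β * btLog β ^ 2))) (orthoTube L 1 v') 1 -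
        c₁ * ((stiffGaussTop L (β / 2) β * Real.exp (-stiffGaussExp L (β / 2) β (linkEmbed L v'))) /
          (∫ u, ({u : GaugeConfig 3 1 SU2 | (∀ k : Fin 3, ‖su2Quat (u (0, k)) - 1‖ ≤ (powScale (1 / 3) β)) ∧ (L : ℝ) ^ 3 * wilsonAction su2Rep u ≤ (powScale (1 / 2) β)}.indicator (fun _ => (1 : ℝ))) u *
            (transferKernel su2Rep ((L : ℝ) ^ 3 * β) (1 : GaugeConfig 3 1 SU2) u / transferKernel su2Rep ((L : ℝ) ^ 3 * β) (1 : GaugeConfig 3 1 SU2) 1) ∂configMeasure SU2 1))| ≤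
        powScale (1 / 5) β * (c₁ * ((stiffGaussTop L (β / 2) β * Real.exp (-stiffGaussExp L (β / 2) β (linkEmbed L v'))) /
          (∫ u, ({u : GaugeConfig 3 1 SU2 | (∀ k : Fin 3, ‖su2Quat (u (0, k)) - 1‖ ≤ (powScale (1 / 3) β)) ∧ (L : ℝ) ^ 3 * wilsonAction su2Rep u ≤ (powScale (1 / 2) β)}.indicator (fun _ => (1 : ℝ))) u *
            (transferKernel su2Rep ((L : ℝ) ^ 3 * β) (1 : GaugeConfig 3 1 SU2) u / transferKernel su2Rep ((L : ℝ) ^ 3 * β) (1 : GaugeConfig 3 1 SU2) 1) ∂configMeasure SU2 1)))) :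
    (1 - powScale (1 / 5) β) *
        (c₁ * stiffGaussTop L (β / 2) β /
          (∫ u, ({u : GaugeConfig 3 1 SU2 | (∀ k : Fin 3, ‖su2Quat (u (0, k)) - 1‖ ≤ (powScale (1 / 3) β)) ∧ (L : ℝ) ^ 3 * wilsonAction su2Rep u ≤ (powScale (1 / 2) β)}.indicator (fun _ => (1 : ℝ))) u *
            (transferKernel su2Rep ((L : ℝ) ^ 3 * β) (1 : GaugeConfig 3 1 SU2) u / transferKernel su2Rep ((L : ℝ) ^ 3 * β) (1 : GaugeConfig 3 1 SU2) 1) ∂configMeasure SU2 1)) *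
        (∫ v, {v : Edge 3 L → Fin 3 → ℝ | ‖linkEmbed L v‖ ≤ min (1 / 40) (powScale (1 / 2) β * btLog β) / 12}.indicator (fun _ => (1 : ℝ)) v *
          (Real.exp (-(stiffGaussExp L (β / 2) β (linkEmbed L v))) ^ 2 * Real.exp (-(‖(gaugeModes L).starProjection (linkEmbed L v)‖ ^ 2 / powScale 1 β ^ 2))) ∂orthoTransverse L) ≤
      btC L β (fun x : LinkSpace L => {x : LinkSpace L | linkCurry x ∈ capBalancedSet L}.indicator (fun _ => (1 : ℝ)) x *
            frozenProfile L (fun β' => stiffGaussExp L (β' / 2) β') (fun β' => min (1 / 40) (powScale (1 / 2) β' * btLog β')) β x)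
          (powScale 1 β) (5 * (powScale (1 / 2) β * btLog β ^ 2)) *
        transferKernel su2Rep ((L : ℝ) ^ 3 * β) (1 : GaugeConfig 3 1 SU2) 1 := by
  haveI := isFiniteMeasure_orthoTransverse L
  -- abbreviations
  set S : ℝ := stiffGaussTop L (β / 2) β with hSdef
  set I₀ : ℝ := ∫ u, ({u : GaugeConfig 3 1 SU2 | (∀ k : Fin 3, ‖su2Quat (u (0, k)) - 1‖ ≤ (powScale (1 / 3) β)) ∧ (L : ℝ) ^ 3 * wilsonAction su2Rep u ≤ (powScale (1 / 2) β)}.indicator (fun _ => (1 : ℝ))) u *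
      (transferKernel su2Rep ((L : ℝ) ^ 3 * β) (1 : GaugeConfig 3 1 SU2) u / transferKernel su2Rep ((L : ℝ) ^ 3 * β) (1 : GaugeConfig 3 1 SU2) 1) ∂configMeasure SU2 1 with hIdef
  set rf : ℝ := min (1 / 40) (powScale (1 / 2) β * btLog β) with hrfdef
  set K₁ : ℝ := transferKernel su2Rep ((L : ℝ) ^ 3 * β) (1 : GaugeConfig 3 1 SU2) 1 with hK₁def
  have hK₁ : 0 < K₁ := transferKernel_pos _ _ _ _
  obtain ⟨hSlo, -⟩ := stiffGaussTop_record_bounds (L := L) hβ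
  have hS : 0 < S := lt_of_lt_of_le (pow_pos (Real.sqrt_pos.2 (by positivity)) _) hSlo
  have hI0 : 0 < I₀ := slowWindow_I0_pos (L := L) (powScale_pos (1 / 3) β) (powScale_pos (1 / 2) β) ((L : ℝ) ^ 3 * β)
  have hrf0 : 0 ≤ rf := le_min (by norm_num) (mul_nonneg (powScale_pos _ _).le (le_trans zero_le_one (one_le_btLog β)))
  -- the profile and weight data
  have hqfm : ∀ β', Measurable ((fun β'' : ℝ => stiffGaussExp L (β'' / 2) β'') β') := fun β' => measurable_stiffGaussExp _ _
  have hqf0 : ∀ β' x, 0 ≤ (fun β'' : ℝ => stiffGaussExp L (β'' / 2) β'') β' x := fun β' x => stiffGaussExp_nonneg _ _ x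
  have hΩGm : Measurable (frozenProfile L (fun β' => stiffGaussExp L (β' / 2) β') (fun β' => min (1 / 40) (powScale (1 / 2) β' * btLog β')) β) :=
    measurable_frozenProfile hqfm _ β
  have hΩG0 : ∀ x, 0 ≤ frozenProfile L (fun β' => stiffGaussExp L (β' / 2) β') (fun β' => min (1 / 40) (powScale (1 / 2) β' * btLog β')) β x :=
    fun x => (frozenProfile_mem_Icc hqf0 _ β x).1
  have hΩG1 : ∀ x, |frozenProfile L (fun β' => stiffGaussExp L (β' / 2) β') (fun β' => min (1 / 40) (powScale (1 / 2) β' * btLog β')) β x| ≤ 1 :=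
    abs_frozenProfile_le hqf0 _ β
  have hΩm := measurable_capRestrict (L := L) hΩGm
  have hΩdat := fun x => capRestrict_mem (L := L) hΩG0 hΩG1 x
  have hWm := measurable_coreWeight (L := L) (powScale 1 β) (5 * (powScale (1 / 2) β * btLog β ^ 2))
  -- the comparison function `A(v) = S·e^{−q(v̂)}/I₀`
  have hAm : Measurable fun v : Edge 3 L → Fin 3 → ℝ => S * Real.exp (-stiffGaussExp L (β / 2) β (linkEmbed L v)) / I₀ :=
    ((measurable_const.mul (((measurable_stiffGaussExp (L := L) (β / 2) β).comp (measurable_linkEmbed L)).neg.exp)).div_const I₀)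
  have hCA : ∀ v : Edge 3 L → Fin 3 → ℝ, |S * Real.exp (-stiffGaussExp L (β / 2) β (linkEmbed L v)) / I₀| ≤ S / I₀ := fun v => by
    rw [abs_of_nonneg (by positivity)]
    refine div_le_div_of_nonneg_right ?_ hI0.le
    have h1 : Real.exp (-stiffGaussExp L (β / 2) β (linkEmbed L v)) ≤ 1 := Real.exp_le_one_iff.mpr (by linarith [stiffGaussExp_nonneg (L := L) (β / 2) β (linkEmbed L v)])
    nlinarith [h1, hS]
  -- the inner set
  set Vin : Set (Edge 3 L → Fin 3 → ℝ) := {v | v ∈ capBalancedSet L ∧ ‖linkEmbed L v‖ ≤ rf / 12} with hVin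
  have hVinm : MeasurableSet Vin := (measurableSet_capBalancedSet L).inter (measurableSet_le (measurable_linkEmbed L).norm measurable_const)
  -- the quasimode floor on `Vin`
  have hlo : ∀ v ∈ Vin, (1 - powScale (1 / 5) β) * c₁ * (S * Real.exp (-stiffGaussExp L (β / 2) β (linkEmbed L v)) / I₀) ≤
      fpFibreTransfer L β (fun x : LinkSpace L => {x : LinkSpace L | linkCurry x ∈ capBalancedSet L}.indicator (fun _ => (1 : ℝ)) x *
          frozenProfile L (fun β' => stiffGaussExp L (β' / 2) β') (fun β' => min (1 / 40) (powScale (1 / 2) β' * btLog β')) β x)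
        (coreWeight L (powScale 1 β) (5 * (powScale (1 / 2) β * btLog β ^ 2))) (orthoTube L 1 v) 1 := by
    intro v hv
    obtain ⟨hvc, hvn⟩ := hv
    have hvT : ∀ (e : Edge 3 L) (c : Fin 3), |v e c| ≤ (9 * (L : ℝ) * (5 * (powScale (1 / 2) β * btLog β ^ 2)) + (powScale 1 β)) := fun e c => by
      have h1 : |v e c| ≤ ‖v e‖ := by
        have := norm_le_pi_norm (v e) c; rwa [Real.norm_eq_abs] at this
      have h2 : ‖v e‖ ≤ ‖linkEmbed L v‖ := norm_apply_le_norm_linkEmbed v e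
      have h3 : rf / 12 ≤ rf := by linarith
      exact h1.trans (h2.trans (hvn.trans (h3.trans (rf_le_schedT (L := L) β))))
    have h := hfloor v hvc hvT hvn
    have hM : S * Real.exp (-stiffGaussExp L (β / 2) β (linkEmbed L v)) / I₀ = (stiffGaussTop L (β / 2) β * Real.exp (-stiffGaussExp L (β / 2) β (linkEmbed L v))) / I₀ := rfl
    rw [hM]
    have h' := (abs_le.mp h).1
    nlinarith [h']
  have hq := fpBOKernel_one_one_ge_of_quasimode (L := L) β hΩm (fun x => (hΩdat x).2.2) (fun x => (hΩdat x).1) hWm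
    (abs_coreWeight_le (L := L) _ _) (fun g => (coreWeight_mem_Icc (L := L) _ _ g).1) hAm hCA hVinm hlo
  -- the integral on the left is `(S/I₀)·M₂^{γ,in}` (cap a.e.)
  have hcapπ : ∀ᵐ v ∂orthoTransverse L, v ∈ capBalancedSet L := by
    rw [ae_iff]; have h0 := orthoTransverse_compl_capBalancedSet L; simpa only [Set.compl_def] using h0
  have hI : ∫ v, Vin.indicator (fun _ => (1 : ℝ)) v *
        ((fun x : LinkSpace L => {x : LinkSpace L | linkCurry x ∈ capBalancedSet L}.indicator (fun _ => (1 : ℝ)) x *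
            frozenProfile L (fun β' => stiffGaussExp L (β' / 2) β') (fun β' => min (1 / 40) (powScale (1 / 2) β' * btLog β')) β x) (linkEmbed L v) *
          (S * Real.exp (-stiffGaussExp L (β / 2) β (linkEmbed L v)) / I₀)) ∂orthoTransverse L =
      S / I₀ * ∫ v, {v : Edge 3 L → Fin 3 → ℝ | ‖linkEmbed L v‖ ≤ rf / 12}.indicator (fun _ => (1 : ℝ)) v *
          (Real.exp (-(stiffGaussExp L (β / 2) β (linkEmbed L v))) ^ 2 * Real.exp (-(‖(gaugeModes L).starProjection (linkEmbed L v)‖ ^ 2 / powScale 1 β ^ 2))) ∂orthoTransverse L := by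
    rw [← integral_const_mul]
    refine integral_congr_ae ?_
    filter_upwards [hcapπ] with v hv
    by_cases hvn : ‖linkEmbed L v‖ ≤ rf / 12
    · have hVmem : v ∈ Vin := ⟨hv, hvn⟩
      rw [Set.indicator_of_mem hVmem, Set.indicator_of_mem (show v ∈ {v : Edge 3 L → Fin 3 → ℝ | ‖linkEmbed L v‖ ≤ rf / 12} from hvn),
        Set.indicator_of_mem ((linkEmbed_mem_capLink_iff v).2 hv)]
      unfold frozenProfile
      have hball : linkEmbed L v ∈ Metric.closedBall (0 : LinkSpace L) (min (1 / 40) (powScale (1 / 2) β * btLog β)) := by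
        rw [Metric.mem_closedBall, dist_zero_right]; rw [← hrfdef]; linarith
      rw [Set.indicator_of_mem hball]
      have e2 : Real.exp (-stiffGaussExp L (β / 2) β (linkEmbed L v)) ^ 2 = Real.exp (-stiffGaussExp L (β / 2) β (linkEmbed L v)) * Real.exp (-stiffGaussExp L (β / 2) β (linkEmbed L v)) := sq _
      rw [e2]
      field_simp
    · have hVmem : v ∉ Vin := fun h => hvn h.2
      rw [Set.indicator_of_notMem hVmem, Set.indicator_of_notMem (show v ∉ {v : Edge 3 L → Fin 3 → ℝ | ‖linkEmbed L v‖ ≤ rf / 12} from hvn)]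
      simp
  rw [hI] at hq
  -- `fpBOKernel(1,1) = btC·K₁`
  have hbt : fpBOKernel L β (fun x : LinkSpace L => {x : LinkSpace L | linkCurry x ∈ capBalancedSet L}.indicator (fun _ => (1 : ℝ)) x *
          frozenProfile L (fun β' => stiffGaussExp L (β' / 2) β') (fun β' => min (1 / 40) (powScale (1 / 2) β' * btLog β')) β x)
        (coreWeight L (powScale 1 β) (5 * (powScale (1 / 2) β * btLog β ^ 2))) 1 1 =
      btC L β (fun x : LinkSpace L => {x : LinkSpace L | linkCurry x ∈ capBalancedSet L}.indicator (fun _ => (1 : ℝ)) x *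
            frozenProfile L (fun β' => stiffGaussExp L (β' / 2) β') (fun β' => min (1 / 40) (powScale (1 / 2) β' * btLog β')) β x)
          (powScale 1 β) (5 * (powScale (1 / 2) β * btLog β ^ 2)) * K₁ := by
    unfold btC; rw [hK₁def, div_mul_cancel₀ _ hK₁.ne']
  rw [hbt] at hq
  have e : (1 - powScale (1 / 5) β) * (c₁ * S / I₀) *
      (∫ v, {v : Edge 3 L → Fin 3 → ℝ | ‖linkEmbed L v‖ ≤ rf / 12}.indicator (fun _ => (1 : ℝ)) v *
        (Real.exp (-(stiffGaussExp L (β / 2) β (linkEmbed L v))) ^ 2 * Real.exp (-(‖(gaugeModes L).starProjection (linkEmbed L v)‖ ^ 2 / powScale 1 β ^ 2))) ∂orthoTransverse L) =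
      (1 - powScale (1 / 5) β) * c₁ * (S / I₀ * ∫ v, {v : Edge 3 L → Fin 3 → ℝ | ‖linkEmbed L v‖ ≤ rf / 12}.indicator (fun _ => (1 : ℝ)) v *
        (Real.exp (-(stiffGaussExp L (β / 2) β (linkEmbed L v))) ^ 2 * Real.exp (-(‖(gaugeModes L).starProjection (linkEmbed L v)‖ ^ 2 / powScale 1 β ^ 2))) ∂orthoTransverse L) := by
    ring
  rw [e]
  exact hq

end Summit.QuantumFields.YangMills.Theorems.FemtoTransferGap.TwoLattice.ConstTube

end
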